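import Summits.QuantumFields.YangMills.Theorems.BalabanUVNodesN17AtRecord13
import Literature.MathematicalPhysics.QuantumFieldTheory.Balaban1983to89.Node00.Record13CoP

/-!
# BalabanUVNodes ∕ node N17 = NE4 AT NODE 00's STAGE-13 RECORD, EDITION v1.5 `CoP` (print's background `U_k(𝐕)` over the COLLAR-re-ranged class, 𝐓-weights without the
# scale-0 regularity cut — director-ym №160∕№161 FIX F7 on FINDING №7; №160 (4) EDITION FREEZE: the last record edition before KEY-20): the CoP twin of companion 20
# (`…N17AtRecord13`, p489645) at def-T's CoP datum `datumOfRecord₁₃CoP θ h` — keyed on the UNCHANGED background-free binder `(h : θ.Provisos₁₃Core F N)`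
# (`Node00/Record13.lean` v1.2 p501191) — and at the flat CoP record class `Node00.IsRecordOfRecord₁₃CCoP` (def-T FILE 23 `Node00/Record13CoP.lean` p520810 ✓ 09:54Z, KEY-23 l.18584)

Cell `pub-ymgap`, HUMAN RULING D-0062, seat `pub-ymgap-dag-n17-c` (R134 fan-out, s2 = BY-NAME KNIT AT THE RECORD), generation 12; companion 24ᶜᵒᴾ = 20ᶜᵒᴾ of the
N17 lineage `BalabanUVNodesN17Knit` … `…N17AtRecord13` (p489645) ∕ `…N17AtRecord13Keys` (p494400) ∕ `…N17AtRateRecord13` (p495996) ∕ `…N17AtRateReadingOfRecord13`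
(p497411) ∕ the ⁗ twins `…N17AtRecord13Sep` (p503884) ∕ `…N17AtRecord13SepKeys` (p505333) ∕ the Co twin `…N17AtRecord13Co` (p516623, which STANDS as the settled
v1.4-era helper, director-ym №160 (5)).  THEOREMS ONLY; imports companion 20 (for its (T, χ)-GENERIC §60 faces `N17_iff_merged_of_βfun_eq_betaOfRecord₈Tχ` ∕ `n17At_…` ∕
`u2Inputs_…` ∕ `N17_of_rates_…`, which are proviso-free and are NOT re-declared) and `Node00/Record13CoP` (which declares `IsRecordOfRecord₁₃CCoP` ∕ `datumOfRecord₁₃CoP`-level faces and imports def-T's `Node00/Record13` v1.2); modifies nothing; every cited lemma used BY NAME.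

WHY THIS FILE.  The record's editions so far: ‴ v1.1 `Provisos₁₃` · ⁗ v1.2 `Provisos₁₃Sep` · ⁵ v1.3 `Provisos₁₃SepMixed` (p511029) · v1.4 = director-ym №152 (β) «print's
background is the minimiser over [6]'s class (1.7) ∧ (1.9)»: def-T FILE 21 `Node00/Record13Co` (p515035) + 22T `Node00/Record13SepCo` (p515749) under KEY-RULE-21 (l.17980:
background-reading RECORD-13 names take the token `Co`; the tower ∕ datum keep the key `(h : θ.Provisos₁₃Core F N)`) · v1.5 = director-ym №160∕№161 FIX F7 on FINDING №7
(the typed 𝐓-weights `WtOfRecord₁₃` carried a multiplicative (1.7)-cut on ALL of `Y = Ωⱼ₊₁ᶜ` including `j = 0`, and the class of record read scale 0 as the whole torus —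
print [Balaban1988Convergent] p.248 (1.10)–(1.11), p.256, [Balaban1985Variational] p.277–278 have the collar only): 12a″ `Node00/TkWeightsOfRecordP` (p519608), def-R 22′
`Node00/LargeFieldBackgroundCoPOfRecord` (p519921), def-T FILE 23 `Node00/Record13CoP` — the `CoP` image of FILE 21 under KEY-23 (l.18584: `Co ↦ CoP` on the cone; the densities
`densOfRecord₁₃ ∕ tdensOfRecord₁₃` and `Provisos₁₃Core` are 12a-free AND background-free, token-identical, CITED) — and 24T `Node00/Record13SepCoP`; №160 (4): no further
edition before KEY-20.  Plan CORE-YES (l.17420) ∕ dag-lead FOLD-152: bg-blind, proviso-FIELD-blind consumer storeys key ONCE on `(hc : θ.Provisos₁₃Core F N)` ∕ the edition's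
Core datum and are applied at the item edition's tuple `(θ, h : θ.Provisos₁₃SepCoP F N)` by `hc := h.toCore`, datum by `rfl` (`datumOfRecord₁₃SepCoP_eq_coP`); the item texts
and the registered stub texts stay keyed on the guarded proviso of record, and a K-composer reaches these faces through RR-2's junction leaf in one line.  N17 reads NO
proviso field, NO background and NO 𝐓-weight: its whole read-out is `βfun = betaOfRecord₁₃ θ` (θ-level: `betaOfRecord₁₃ ∕ TcanOfRecord ∕ chiβOfRecord₁₃ ∕ betaMerged …`), so
for N17 every re-base since v1.1 is a DATUM-TOKEN change only — every sentence below has the content of its ‴ ∕ ⁗ ∕ Co original with the SAME `βmTχ`.  This file is companion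
20 §61–§63 under the token map `Provisos₁₃ ↦ Provisos₁₃Core`, `datumOfRecord₁₃ ↦ datumOfRecord₁₃CoP`, `IsRecordOfRecord₁₃C ↦ IsRecordOfRecord₁₃CCoP` (equivalently the Co twin
p516623 under `Co ↦ CoP`), every proof VERBATIM under the map (generator `pub-ymgap-dag-n17-c/tools/rekey13_n17.py --suffix CoP --provisos-suffix Core --keypos afterC`).
§61ᶜᵒᴾ N17 at `datumOfRecord₁₃CoP θ h` = §60 at `βfun_datumOfRecord₁₃CoP_eq_betaOfRecord₈Tχ` (`rfl`): `NE4OnData (datumOfRecord₁₃CoP F N θ h) c ρ γ' ↔ ScaleShiftRate c ρ γ' βmTχ` on boxes `γ' ≤ θ.γ`,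
`βmTχ := betaMerged F (mergedTermFamilyMatT F N (TcanOfRecord F N) (chiβOfRecord₁₃ F N θ) θ.εbg) θ.ρ8 θ.bV` (UNCHANGED — θ-level), + split road ∕ content ∕ kernel
currency ∕ cap; §62ᶜᵒᴾ the ∀-forms at `IsRecordOfRecord₁₃CCoP F N D w` (charted witness of `exists_chart_scaleShiftRate_of_N17₁₃CoP`, NO transport conjunct — Record13
carries no β-version field); §63ᶜᵒᴾ the one-application closers of `YMDAG.UVSplit.S_N17 RRec` for homes keyed over `Stage13Params` with `Provisos₁₃Core`
whose datum slot is `datumOfRecord₁₃CoP θ h` ∕ over `IsRecordOfRecord₁₃CCoP` (the U3 road `S_D4 → S_N18 → S_N17` is `YMDAG.N17.s_N17_of_D4_N18`, record-generic, and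
needs no twin).  The keyed ∕ home faces at RR-2's CoP datum key (`Node00/Record13DatumKeyCoP`) follow in 21ᶜᵒᴾ; CoP rate homes (n22-e) in 22ᶜᵒᴾ ∕ 23ᶜᵒᴾ on ask only.

HONEST FRAMING.  Kernel bookkeeping BY NAME; 0 sorry; NE4 NOT IN PRINT ([Balaban1987RG1] (1.20)–(1.22) p. 264, p. 298) and NOT PROVED; every rate input a
displayed HYPOTHESIS (rows NE2 ∕ NE3 ∕ NE5 = N15 ∕ N16 ∕ N18 and (D4) through (1.22); (UD) = (5.10) p. 293 printed for Bałaban's kernels, a hypothesis here);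
the Core provisos are never assumed except as the record predicate's own conjunct; NO inhabitant of `IsRecordOfRecord₁₃CCoP` is claimed (K0 open at every
edition); nothing of Bałaban's asserted; N17 = composite (max of N15, N16, (D4)), NOT discharged; «A: n∕28» unmoved.  One finite 𝕋⁴ at fixed ε per run — NOT ℝ⁴,
NOT OS, NOT a mass gap, NOT Clay.
-/

noncomputable section

open scoped Matrix.Norms.L2Operator
namespace Summit.QuantumFields.YangMills.Theorems.BalabanUVNodesN17

open Literature.MathematicalPhysics.QuantumFieldTheory.Balaban1983to89
open Literature.MathematicalPhysics.QuantumFieldTheory.Balaban1983to89.FlowStep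
open Literature.MathematicalPhysics.QuantumFieldTheory.Balaban1983to89.T4CouplingMatching
open Literature.MathematicalPhysics.QuantumFieldTheory.Balaban1983to89.T4Continuum (T4Family FiniteEpsData ULoop)
open Literature.MathematicalPhysics.QuantumFieldTheory.Balaban1983to89.B12Sec2to5 (Decay510 betaPrime510)
open Literature.MathematicalPhysics.QuantumFieldTheory.Balaban1983to89.Beta.LimitRate (subKernel)
open Literature.MathematicalPhysics.QuantumFieldTheory.Balaban1983to89.Node00
open Literature.MathematicalPhysics.QuantumFieldTheory.Balaban1983to89.DagBinding (WorldP)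
open Summit.QuantumFields.BalabanUV.T4Continuum.Spine.NE4 (NE4OnData U2Inputs ne4OnData_iff)
open YMDAG.UVSplit (Datum U3Carriers RateCarriers RateRecordPred N17At S_N17)

variable {F : T4Family} {N : ℕ} [NeZero N]

/-! ## §61 N17 AT THE STAGE-13 DATUM `datumOfRecord₁₃CoP F N θ h` — `βfun` IS the `(TcanOfRecord, chiβOfRecord₁₃ θ)` assembly line (`rfl`) -/

/-- **THE STAGE-13 DATUM's β-FUNCTIONS ARE THE DEFINER's ASSEMBLY LINE OVER THE CANONICAL-VERSION TRANSPORT AT THE (2.9) SPECIES** (`rfl` through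
`βfun_datumOfRecord₁₃CoP`, `betaOfRecord₁₃`, `betaOfRecord₈Tχ`): `βfun = betaOfMerged βmTχ (beta0OfMerged βmTχ θ.v₀) θ.γ`. [cite: Balaban1987RG1, (1.20)-(1.22) p.264, (2.9) p.266] -/
theorem βfun_datumOfRecord₁₃CoP_eq_mergedTχ (θ : Stage13Params F N) (h : θ.Provisos₁₃Core F N) :
    (datumOfRecord₁₃CoP F N θ h).βfun =
      letI := θ.instVβ₁; letI := θ.instVβ₂; letI := θ.instιβ
      betaOfMerged (betaMerged F (mergedTermFamilyMatT F N (TcanOfRecord F N) (chiβOfRecord₁₃ F N θ) θ.εbg) θ.ρ8 θ.bV)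
        (beta0OfMerged (betaMerged F (mergedTermFamilyMatT F N (TcanOfRecord F N) (chiβOfRecord₁₃ F N θ) θ.εbg) θ.ρ8 θ.bV) θ.v₀) θ.γ := rfl

/-- **N17 AT THE STAGE-13 DATUM IS THE SCALE-SHIFT RATE OF `betaOfRecord₁₃ θ`** on EVERY box side `γ'` (no cap; `Iff.rfl`). [cite: Balaban1987RG1, (1.20)-(1.22) p.264] -/
theorem N17_datumOfRecord₁₃CoP_iff_betaOfRecord₁₃ (θ : Stage13Params F N) (h : θ.Provisos₁₃Core F N) (c ρ γ' : ℝ) :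
    NE4OnData (datumOfRecord₁₃CoP F N θ h) c ρ γ' ↔ ScaleShiftRate c ρ γ' (betaOfRecord₁₃ F N θ) := Iff.rfl

/-- **N17 AT THE STAGE-13 DATUM READS THE CANONICAL-VERSION MERGED β AT THE (2.9) SPECIES** on every box side `γ' ≤ θ.γ`:
`NE4OnData (datumOfRecord₁₃CoP F N θ h) c ρ γ' ↔ ScaleShiftRate c ρ γ' βmTχ` (§60 at Record13's `βfun_datumOfRecord₁₃CoP_eq_betaOfRecord₈Tχ`). [cite: Balaban1987RG1, (1.20)-(1.22) p.264] -/
theorem N17_datumOfRecord₁₃CoP_iff_merged (θ : Stage13Params F N) (h : θ.Provisos₁₃Core F N) {c ρ γ' : ℝ} (hγ : γ' ≤ θ.γ) :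
    NE4OnData (datumOfRecord₁₃CoP F N θ h) c ρ γ' ↔
      letI := θ.instVβ₁; letI := θ.instVβ₂; letI := θ.instιβ
      ScaleShiftRate c ρ γ'
        (betaMerged F (mergedTermFamilyMatT F N (TcanOfRecord F N) (chiβOfRecord₁₃ F N θ) θ.εbg) θ.ρ8 θ.bV) :=
  N17_iff_merged_of_βfun_eq_betaOfRecord₈Tχ (βfun_datumOfRecord₁₃CoP_eq_betaOfRecord₈Tχ F N θ h) hγ

/-- **NODE U2's INPUT TRIPLE AT THE STAGE-13 DATUM** (box `γ' ≤ θ.γ`): the `βmTχ` rate ∧ its history moduli ∧ fading memory. [cite: Balaban1987RG1, §5 p.298] -/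
theorem u2Inputs_datumOfRecord₁₃CoP_iff (θ : Stage13Params F N) (h : θ.Provisos₁₃Core F N) {c C ρ γ' : ℝ} {Λ : ℕ → ℕ → ℝ} (hγ : γ' ≤ θ.γ) :
    U2Inputs (datumOfRecord₁₃CoP F N θ h) c C ρ γ' Λ ↔
      letI := θ.instVβ₁; letI := θ.instVβ₂; letI := θ.instιβ
      ScaleShiftRate c ρ γ' (betaMerged F (mergedTermFamilyMatT F N (TcanOfRecord F N) (chiβOfRecord₁₃ F N θ) θ.εbg) θ.ρ8 θ.bV) ∧
        HistLipschitz Λ γ' (betaMerged F (mergedTermFamilyMatT F N (TcanOfRecord F N) (chiβOfRecord₁₃ F N θ) θ.εbg) θ.ρ8 θ.bV) ∧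
        FadingMemory C ρ Λ :=
  u2Inputs_iff_of_βfun_eq_betaOfRecord₈Tχ (βfun_datumOfRecord₁₃CoP_eq_betaOfRecord₈Tχ F N θ h) hγ

/-- **… IN CLUSTER K4's LETTERS** [bookkeeping]: `N17At (datumOfRecord₁₃CoP F N θ h) u ↔` the `βmTχ` rate at `(u.cr·u.C₅·u.θ, u.ρ, u.γ)`, `u.γ ≤ θ.γ`. [cite: Balaban1987RG1, (1.20)-(1.22) p.264] -/
theorem n17At_datumOfRecord₁₃CoP_iff_merged (θ : Stage13Params F N) (h : θ.Provisos₁₃Core F N) (u : U3Carriers) (hγ : u.γ ≤ θ.γ) :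
    N17At (datumOfRecord₁₃CoP F N θ h) u ↔
      letI := θ.instVβ₁; letI := θ.instVβ₂; letI := θ.instιβ
      ScaleShiftRate (u.cr * u.C₅ * u.θ) u.ρ u.γ
        (betaMerged F (mergedTermFamilyMatT F N (TcanOfRecord F N) (chiβOfRecord₁₃ F N θ) θ.εbg) θ.ρ8 θ.bV) :=
  N17_datumOfRecord₁₃CoP_iff_merged θ h hγ

/-- **THE SPLIT ROAD AT THE STAGE-13 DATUM**: (AF-0r) for `beta0OfMerged βmTχ θ.v₀` (N15's currency) ∧ the merged remainder's rate (N16 ∕ N18), `γ' ≤ θ.γ`,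
`0 ≤ ρ ≤ 1`, `0 ≤ c₀` ⟹ `NE4OnData D₁₃ (2c₀ + c₁) ρ γ'` (§60).  Both binders UNPRINTED. [cite: Balaban1987RG1, (2.12)-(2.14) p.268] -/
theorem N17_datumOfRecord₁₃CoP_of_rates (θ : Stage13Params F N) (h : θ.Provisos₁₃Core F N) {binf c₀ c₁ ρ γ' : ℝ} (hγ : γ' ≤ θ.γ) (hρ0 : 0 ≤ ρ)
    (hρ1 : ρ ≤ 1) (hc₀ : 0 ≤ c₀)
    (hconv : letI := θ.instVβ₁; letI := θ.instVβ₂; letI := θ.instιβ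
      ∀ k, |beta0OfMerged (betaMerged F (mergedTermFamilyMatT F N (TcanOfRecord F N) (chiβOfRecord₁₃ F N θ) θ.εbg) θ.ρ8 θ.bV) θ.v₀ k -
        binf| ≤ c₀ * ρ ^ k)
    (hrem : letI := θ.instVβ₁; letI := θ.instVβ₂; letI := θ.instιβ
      ScaleShiftRate c₁ ρ γ' fun k w =>
        betaMerged F (mergedTermFamilyMatT F N (TcanOfRecord F N) (chiβOfRecord₁₃ F N θ) θ.εbg) θ.ρ8 θ.bV k w -
          beta0OfMerged (betaMerged F (mergedTermFamilyMatT F N (TcanOfRecord F N) (chiβOfRecord₁₃ F N θ) θ.εbg) θ.ρ8 θ.bV) θ.v₀ k) :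
    NE4OnData (datumOfRecord₁₃CoP F N θ h) (2 * c₀ + c₁) ρ γ' :=
  N17_of_rates_of_βfun_eq_betaOfRecord₈Tχ (βfun_datumOfRecord₁₃CoP_eq_betaOfRecord₈Tχ F N θ h) hγ hρ0 hρ1 hc₀ hconv hrem

/-- **WHAT N17 DELIVERS AT THE STAGE-13 DATUM.**  On a box side `0 < γ' ≤ θ.γ` with `0 ≤ ρ < 1`, `Beta0LimitExists βmTχ θ.v₀` at COHERENT reference histories
with entries in `]0,γ']`: `NE4OnData D₁₃ c ρ γ'` ALONE yields (AF-0r) `∃ β⁰_∞, |β⁰_{k+1} − β⁰_∞| ≤ (c∕(1−ρ))ρ^k` for `beta0OfMerged βmTχ θ.v₀` AND the merged remainder's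
rate (companion 4 `atRecord_content_of_scaleShiftRate_merged`). [cite: Balaban1987RG1, (2.12)-(2.14) p.268] -/
theorem content_of_N17_datumOfRecord₁₃CoP (θ : Stage13Params F N) (h : θ.Provisos₁₃Core F N) {c ρ γ' : ℝ} (hγ : γ' ≤ θ.γ) (hγ' : 0 < γ')
    (hρ0 : 0 ≤ ρ) (hρ1 : ρ < 1)
    (hlim : letI := θ.instVβ₁; letI := θ.instVβ₂; letI := θ.instιβ
      Beta0LimitExists (betaMerged F (mergedTermFamilyMatT F N (TcanOfRecord F N) (chiβOfRecord₁₃ F N θ) θ.εbg) θ.ρ8 θ.bV) θ.v₀)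
    (hcoh : ∀ k, Fin.tail (θ.v₀ (k + 1)) = θ.v₀ k) (hadm : ∀ k i, 0 < θ.v₀ k i ∧ θ.v₀ k i ≤ γ')
    (hN17 : NE4OnData (datumOfRecord₁₃CoP F N θ h) c ρ γ') :
    letI := θ.instVβ₁; letI := θ.instVβ₂; letI := θ.instιβ
    (∃ binf : ℝ, ∀ k,
        |beta0OfMerged (betaMerged F (mergedTermFamilyMatT F N (TcanOfRecord F N) (chiβOfRecord₁₃ F N θ) θ.εbg) θ.ρ8 θ.bV) θ.v₀ k - binf| ≤
          c / (1 - ρ) * ρ ^ k) ∧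
      ScaleShiftRate (c + 2 * (c / (1 - ρ))) ρ γ' (fun k w =>
        betaMerged F (mergedTermFamilyMatT F N (TcanOfRecord F N) (chiβOfRecord₁₃ F N θ) θ.εbg) θ.ρ8 θ.bV k w -
          beta0OfMerged (betaMerged F (mergedTermFamilyMatT F N (TcanOfRecord F N) (chiβOfRecord₁₃ F N θ) θ.εbg) θ.ρ8 θ.bV) θ.v₀ k) := by
  letI := θ.instVβ₁; letI := θ.instVβ₂; letI := θ.instιβ
  exact (atRecord_content_of_scaleShiftRate_merged hγ hγ' hρ0 hρ1 hlim hcoh hadm ((N17_datumOfRecord₁₃CoP_iff_merged θ h hγ).mp hN17)).2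

/-- **N17 AT THE STAGE-13 DATUM END TO END IN KERNEL CURRENCY** (companion 4 `N17_atAssemblyLine_of_kernelStepRate`): (UD) — (5.10)-decay of the record's OWN
limiting polarisation kernels `polLimit F (k+1) (ℰ k v ·) θ.ρ8 θ.bV` of the `(TcanOfRecord, χβ₁₃)` family on the boxes `]0,γ']` — ∧ their HISTORY-MATCHED STEP RATE
`|Π_{k+2}(w; x) − Π_{k+1}(tail w; x)| ≤ C′ρ^k e^{−δ′|x|₁}`, `0 < γ' ≤ θ.γ`, `0 ≤ ρ < 1`, `Beta0LimitExists` at coherent admissible `θ.v₀` ⟹ `NE4OnData D₁₃ (β′(C′,δ′)) ρ γ'`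
∧ (AF-0r).  (UD) PRINTED for Bałaban's kernels, a hypothesis here; the step rate NOT PRINTED (rows NE2 ∕ NE3 ∕ NE5). [cite: Balaban1987RG1, (1.21)-(1.22) p.264 and (5.10) p.293] -/
theorem N17_datumOfRecord₁₃CoP_of_kernelStepRate (θ : Stage13Params F N) (h : θ.Provisos₁₃Core F N) {C δ C' δ' ρ γ' : ℝ} (hγ : γ' ≤ θ.γ)
    (hγ' : 0 < γ') (hρ0 : 0 ≤ ρ) (hρ1 : ρ < 1) (hδ : 0 < δ) (hδ' : 0 < δ')
    (hU : letI := θ.instVβ₁; letI := θ.instVβ₂; letI := θ.instιβ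
      ∀ k (v : Fin (k + 1) → ℝ), v ∈ Box γ' k →
        Decay510 (polLimit F (k + 1)
          (fun K => mergedTermFamilyMatT F N (TcanOfRecord F N) (chiβOfRecord₁₃ F N θ) θ.εbg k v K) θ.ρ8 θ.bV 0 1) C δ)
    (hS : letI := θ.instVβ₁; letI := θ.instVβ₂; letI := θ.instιβ
      ∀ k (w : Fin (k + 2) → ℝ), w ∈ Box γ' (k + 1) →
        Decay510 (subKernel
          (polLimit F (k + 1 + 1) (fun K => mergedTermFamilyMatT F N (TcanOfRecord F N) (chiβOfRecord₁₃ F N θ) θ.εbg (k + 1) w K) θ.ρ8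
            θ.bV)
          (polLimit F (k + 1) (fun K => mergedTermFamilyMatT F N (TcanOfRecord F N) (chiβOfRecord₁₃ F N θ) θ.εbg k (Fin.tail w) K) θ.ρ8
            θ.bV) 0 1) (C' * ρ ^ k) δ')
    (hlim : letI := θ.instVβ₁; letI := θ.instVβ₂; letI := θ.instιβ
      Beta0LimitExists (betaMerged F (mergedTermFamilyMatT F N (TcanOfRecord F N) (chiβOfRecord₁₃ F N θ) θ.εbg) θ.ρ8 θ.bV) θ.v₀)
    (hcoh : ∀ k, Fin.tail (θ.v₀ (k + 1)) = θ.v₀ k) (hadm : ∀ k i, 0 < θ.v₀ k i ∧ θ.v₀ k i ≤ γ') :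
    NE4OnData (datumOfRecord₁₃CoP F N θ h) (betaPrime510 4 C' δ') ρ γ' ∧
      letI := θ.instVβ₁; letI := θ.instVβ₂; letI := θ.instιβ
      ∃ binf : ℝ, ∀ k,
        |beta0OfMerged (betaMerged F (mergedTermFamilyMatT F N (TcanOfRecord F N) (chiβOfRecord₁₃ F N θ) θ.εbg) θ.ρ8 θ.bV) θ.v₀ k - binf| ≤
          betaPrime510 4 C' δ' / (1 - ρ) * ρ ^ k := by
  letI := θ.instVβ₁; letI := θ.instVβ₂; letI := θ.instιβ
  exact N17_atAssemblyLine_of_kernelStepRate _ _ θ.ρ8 θ.bV (βfun_datumOfRecord₁₃CoP_eq_mergedTχ θ h) hγ hγ' hρ0 hρ1 hδ hδ' hU hS hlim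
    hcoh hadm

/-- **THE CAP AT STAGE 13, as an `iff`** (companion 5 §20): at admissible Stage-13 parameters, on a box LARGER than the record box (`θ.γ < γ'`), `NE4OnData D₁₃ c ρ γ'`
IFF `βmTχ` satisfies NE4 on the record box ∧ is uniformly `cρ^k`-close there to the next one-loop number ∧ the one-loop numbers of record are geometrically
Cauchy — the crux text takes `γ' ≤ θ.γ`. [cite: Balaban1987RG1, (1.22) p.264 («defined on the interval [0, γ]»)] -/
theorem N17_datumOfRecord₁₃CoP_iff_of_lt (θ : Stage13Params F N) (h : θ.Provisos₁₃Core F N) (hθ : θ.Admissible F N) {c ρ γ' : ℝ} (hlt : θ.γ < γ') :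
    NE4OnData (datumOfRecord₁₃CoP F N θ h) c ρ γ' ↔
      letI := θ.instVβ₁; letI := θ.instVβ₂; letI := θ.instιβ
      ScaleShiftRate c ρ θ.γ (betaMerged F (mergedTermFamilyMatT F N (TcanOfRecord F N) (chiβOfRecord₁₃ F N θ) θ.εbg) θ.ρ8 θ.bV) ∧
        (∀ k (v : Fin (k + 1) → ℝ), v ∈ Box θ.γ k →
          |beta0OfMerged (betaMerged F (mergedTermFamilyMatT F N (TcanOfRecord F N) (chiβOfRecord₁₃ F N θ) θ.εbg) θ.ρ8 θ.bV) θ.v₀ (k + 1) -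
              betaMerged F (mergedTermFamilyMatT F N (TcanOfRecord F N) (chiβOfRecord₁₃ F N θ) θ.εbg) θ.ρ8 θ.bV k v| ≤ c * ρ ^ k) ∧
        (∀ k, |beta0OfMerged (betaMerged F (mergedTermFamilyMatT F N (TcanOfRecord F N) (chiβOfRecord₁₃ F N θ) θ.εbg) θ.ρ8 θ.bV) θ.v₀ (k + 1) -
            beta0OfMerged (betaMerged F (mergedTermFamilyMatT F N (TcanOfRecord F N) (chiβOfRecord₁₃ F N θ) θ.εbg) θ.ρ8 θ.bV) θ.v₀ k| ≤
          c * ρ ^ k) := by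
  letI := θ.instVβ₁; letI := θ.instVβ₂; letI := θ.instιβ
  have h0 : 0 < θ.γ := hθ.toStage9.gamma_pos
  rw [ne4OnData_iff, βfun_datumOfRecord₁₃CoP_eq_mergedTχ]
  exact scaleShiftRate_betaOfMerged_iff_of_lt (h0.trans hlt) hlt

/-! ## §62 N17 AT THE RECORD PREDICATE `IsRecordOfRecord₁₃CCoP F N D w` — ∀-forms over admissible θ WITH `Provisos₁₃Core` (charted; no transport proviso exists) -/

/-- **N17 AT A STAGE-13 RECORD `(D, w)`.**  If at EVERY admissible Stage-13 parameter with its provisos whose datum is `D` and whose record box contains the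
world's window the canonical-version merged β `βmTχ` satisfies `ScaleShiftRate cN ρ w.γ`, then `NE4OnData D cN ρ w.γ` (chart clause, box side `w.γ ≤ θ.γ` and
its positivity are CLAUSES of `IsRecordOfRecord₁₃CCoP`).  Hypothesis displayed, not asserted. [cite: Balaban1987RG1, (1.20)-(1.22) p.264; Balaban1989LargeFieldII, Thm 1 p.355] -/
theorem N17_of_isRecordOfRecord₁₃CCoP {D : Datum F N} {w : WorldP} (h : IsRecordOfRecord₁₃CCoP F N D w) {cN ρ : ℝ}
    (hin : ∀ (θ : Stage13Params F N) (hP : θ.Provisos₁₃Core F N), θ.Admissible F N → D = datumOfRecord₁₃CoP F N θ hP → w.γ ≤ θ.γ →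
      letI := θ.instVβ₁; letI := θ.instVβ₂; letI := θ.instιβ
      ScaleShiftRate cN ρ w.γ (betaMerged F (mergedTermFamilyMatT F N (TcanOfRecord F N) (chiβOfRecord₁₃ F N θ) θ.εbg) θ.ρ8 θ.bV)) :
    NE4OnData D cN ρ w.γ := by
  obtain ⟨θ, hP, hθ, hD, -, ⟨-, hγle⟩, -, -⟩ := h
  have hm := hin θ hP hθ hD hγle
  subst hD
  exact (N17_datumOfRecord₁₃CoP_iff_merged θ hP hγle).mpr hm

/-- **AT A STAGE-13 RECORD THE θ-KEYED BINDER IS EQUIVALENT TO N17** (kernel): `NE4OnData D cN ρ w.γ` holds IFF the `βmTχ` rate `ScaleShiftRate cN ρ w.γ` holds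
at EVERY admissible Stage-13 presentation `(θ, hP)` of `D` with `w.γ ≤ θ.γ` (N17 reads `D.βfun` only; at each presentation `D.βfun` IS that θ's assembly line on
`]0, w.γ] ⊆ ]0, θ.γ]`) — §62's ∀-form loses nothing. [cite: Balaban1987RG1, (1.20)-(1.22) p.264; Balaban1989LargeFieldII, Thm 1 p.355] -/
theorem N17_iff_forall_of_isRecordOfRecord₁₃CCoP {D : Datum F N} {w : WorldP} (h : IsRecordOfRecord₁₃CCoP F N D w) (cN ρ : ℝ) :
    NE4OnData D cN ρ w.γ ↔
      ∀ (θ : Stage13Params F N) (hP : θ.Provisos₁₃Core F N), θ.Admissible F N → D = datumOfRecord₁₃CoP F N θ hP → w.γ ≤ θ.γ →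
        letI := θ.instVβ₁; letI := θ.instVβ₂; letI := θ.instιβ
        ScaleShiftRate cN ρ w.γ (betaMerged F (mergedTermFamilyMatT F N (TcanOfRecord F N) (chiβOfRecord₁₃ F N θ) θ.εbg) θ.ρ8 θ.bV) := by
  refine ⟨fun hN θ hP _ hD hle => ?_, N17_of_isRecordOfRecord₁₃CCoP h⟩
  subst hD
  exact (N17_datumOfRecord₁₃CoP_iff_merged θ hP hle).mp hN

/-- **N17 AT A STAGE-13 RECORD BY THE SPLIT ROAD**: (AF-0r) for `beta0OfMerged βmTχ θ.v₀` (`c₀ ≥ 0`; N15's currency) ∧ the merged remainder's rate (`c₁`;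
N16 ∕ N18) on the world's window, asked of every admissible witness with provisos, `0 ≤ ρ ≤ 1` ⟹ `NE4OnData D (2c₀ + c₁) ρ w.γ`. [cite: Balaban1987RG1, (2.12)-(2.14) p.268] -/
theorem N17_of_isRecordOfRecord₁₃CCoP_rates {D : Datum F N} {w : WorldP} (h : IsRecordOfRecord₁₃CCoP F N D w) {c₀ c₁ ρ : ℝ}
    (hρ0 : 0 ≤ ρ) (hρ1 : ρ ≤ 1) (hc₀ : 0 ≤ c₀)
    (hin : ∀ (θ : Stage13Params F N) (hP : θ.Provisos₁₃Core F N), θ.Admissible F N → D = datumOfRecord₁₃CoP F N θ hP → w.γ ≤ θ.γ →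
      letI := θ.instVβ₁; letI := θ.instVβ₂; letI := θ.instιβ
      ∃ binf : ℝ,
        (∀ k, |beta0OfMerged (betaMerged F (mergedTermFamilyMatT F N (TcanOfRecord F N) (chiβOfRecord₁₃ F N θ) θ.εbg) θ.ρ8 θ.bV) θ.v₀ k -
            binf| ≤ c₀ * ρ ^ k) ∧
        ScaleShiftRate c₁ ρ w.γ fun k v =>
          betaMerged F (mergedTermFamilyMatT F N (TcanOfRecord F N) (chiβOfRecord₁₃ F N θ) θ.εbg) θ.ρ8 θ.bV k v -
            beta0OfMerged (betaMerged F (mergedTermFamilyMatT F N (TcanOfRecord F N) (chiβOfRecord₁₃ F N θ) θ.εbg) θ.ρ8 θ.bV) θ.v₀ k) :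
    NE4OnData D (2 * c₀ + c₁) ρ w.γ := by
  obtain ⟨θ, hP, hθ, hD, -, ⟨-, hγle⟩, -, -⟩ := h
  obtain ⟨binf, hconv, hrem⟩ := hin θ hP hθ hD hγle
  subst hD
  exact N17_datumOfRecord₁₃CoP_of_rates θ hP hγle hρ0 hρ1 hc₀ hconv hrem

/-- **N17 AT A STAGE-13 RECORD IN KERNEL CURRENCY — the content form.**  (UD) ((5.10)-decay, some `C`, `δ > 0` per witness) ∧ the HISTORY-MATCHED STEP RATE
`|Π_{k+2}(w; x) − Π_{k+1}(tail w; x)| ≤ C′ρ^k e^{−δ′|x|₁}` (fixed `C′`, `δ′ > 0`) of the record's OWN `Node00.polLimit` kernels of the `(TcanOfRecord, χβ₁₃)` family,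
on the world's window, asked of every admissible Stage-13 witness with provisos ⟹ `NE4OnData D (β′(C′,δ′)) ρ w.γ` (companion 4
`scaleShiftRate_betaMerged_of_kernelStepRate`).  (UD) PRINTED for Bałaban's kernels, the step rate NOT. [cite: Balaban1987RG1, (1.21)-(1.22) p.264 and (5.10) p.293] -/
theorem N17_of_isRecordOfRecord₁₃CCoP_kernelStepRate {D : Datum F N} {w : WorldP} (h : IsRecordOfRecord₁₃CCoP F N D w) {C' δ' ρ : ℝ}
    (hδ' : 0 < δ')
    (hin : ∀ (θ : Stage13Params F N) (hP : θ.Provisos₁₃Core F N), θ.Admissible F N → D = datumOfRecord₁₃CoP F N θ hP → w.γ ≤ θ.γ →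
      letI := θ.instVβ₁; letI := θ.instVβ₂; letI := θ.instιβ
      (∃ C δ : ℝ, 0 < δ ∧ ∀ k (v : Fin (k + 1) → ℝ), v ∈ Box w.γ k →
        Decay510 (polLimit F (k + 1)
          (fun K => mergedTermFamilyMatT F N (TcanOfRecord F N) (chiβOfRecord₁₃ F N θ) θ.εbg k v K) θ.ρ8 θ.bV 0 1) C δ) ∧
      (∀ k (u : Fin (k + 2) → ℝ), u ∈ Box w.γ (k + 1) →
        Decay510 (subKernel
          (polLimit F (k + 1 + 1) (fun K => mergedTermFamilyMatT F N (TcanOfRecord F N) (chiβOfRecord₁₃ F N θ) θ.εbg (k + 1) u K) θ.ρ8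
            θ.bV)
          (polLimit F (k + 1) (fun K => mergedTermFamilyMatT F N (TcanOfRecord F N) (chiβOfRecord₁₃ F N θ) θ.εbg k (Fin.tail u) K) θ.ρ8
            θ.bV) 0 1) (C' * ρ ^ k) δ')) :
    NE4OnData D (betaPrime510 4 C' δ') ρ w.γ := by
  obtain ⟨θ, hP, hθ, hD, -, ⟨-, hγle⟩, -, -⟩ := h
  obtain ⟨⟨C, δ, hδ, hU⟩, hS⟩ := hin θ hP hθ hD hγle
  subst hD
  letI := θ.instVβ₁; letI := θ.instVβ₂; letI := θ.instιβ
  exact (N17_datumOfRecord₁₃CoP_iff_merged θ hP hγle).mpr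
    (scaleShiftRate_betaMerged_of_kernelStepRate F (mergedTermFamilyMatT F N (TcanOfRecord F N) (chiβOfRecord₁₃ F N θ) θ.εbg) θ.ρ8 θ.bV
      hδ hδ' hU hS)

/-- **NODE U2's INPUT TRIPLE AT A STAGE-13 RECORD** (the N17 → N27 edge's input), asked of every admissible witness with provisos. [cite: Balaban1987RG1, §5 p.298] -/
theorem u2Inputs_of_isRecordOfRecord₁₃CCoP {D : Datum F N} {w : WorldP} (h : IsRecordOfRecord₁₃CCoP F N D w) {cN C ρ : ℝ}
    {Λ : ℕ → ℕ → ℝ} (hF : FadingMemory C ρ Λ)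
    (hin : ∀ (θ : Stage13Params F N) (hP : θ.Provisos₁₃Core F N), θ.Admissible F N → D = datumOfRecord₁₃CoP F N θ hP → w.γ ≤ θ.γ →
      letI := θ.instVβ₁; letI := θ.instVβ₂; letI := θ.instιβ
      ScaleShiftRate cN ρ w.γ (betaMerged F (mergedTermFamilyMatT F N (TcanOfRecord F N) (chiβOfRecord₁₃ F N θ) θ.εbg) θ.ρ8 θ.bV) ∧
        HistLipschitz Λ w.γ (betaMerged F (mergedTermFamilyMatT F N (TcanOfRecord F N) (chiβOfRecord₁₃ F N θ) θ.εbg) θ.ρ8 θ.bV)) :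
    U2Inputs D cN C ρ w.γ Λ := by
  obtain ⟨θ, hP, hθ, hD, -, ⟨-, hγle⟩, -, -⟩ := h
  obtain ⟨hm, hL⟩ := hin θ hP hθ hD hγle
  subst hD
  exact (u2Inputs_datumOfRecord₁₃CoP_iff θ hP hγle).mpr ⟨hm, hL, hF⟩

/-- **`2 ≤ N`: N17 AT A ₁₃C RECORD IS AN η-RATE STATEMENT ABOUT THE CANONICAL-VERSION MERGED β THROUGH A GENUINE CHART — WITH NO TRANSPORT CONJUNCT**
(kernel; new at ₁₃): from `IsRecordOfRecord₁₃CCoP F N D w` and `NE4OnData D c ρ w.γ` one obtains an admissible Stage-13 witness θ with provisos, `θ.ρ8 ≠ 0`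
(`Admissible.toStage9.chart` + `IsChartOfRecord.rho8_ne_zero`), `w.γ ≤ θ.γ`, `D` its datum, AND `ScaleShiftRate c ρ w.γ βmTχ` — no `HasContTransportAlong`
clause exists to extract (Record13 carries no β-version field, director LINE №128 D2 (i′)). [cite: Balaban1987RG1, (0.13) p.254 and (1.20)-(1.22) p.264] -/
theorem exists_chart_scaleShiftRate_of_N17₁₃CoP {D : Datum F N} {w : WorldP} (h : IsRecordOfRecord₁₃CCoP F N D w) (hN : 2 ≤ N) {c ρ : ℝ}
    (hN17 : NE4OnData D c ρ w.γ) :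
    ∃ (θ : Stage13Params F N) (hP : θ.Provisos₁₃Core F N), θ.Admissible F N ∧ (letI := θ.instVβ₁; letI := θ.instVβ₂; θ.ρ8) ≠ 0 ∧
      w.γ ≤ θ.γ ∧ D = datumOfRecord₁₃CoP F N θ hP ∧
      letI := θ.instVβ₁; letI := θ.instVβ₂; letI := θ.instιβ
      ScaleShiftRate c ρ w.γ (betaMerged F (mergedTermFamilyMatT F N (TcanOfRecord F N) (chiβOfRecord₁₃ F N θ) θ.εbg) θ.ρ8 θ.bV) := by
  obtain ⟨θ, hP, hθ, hD, -, ⟨-, hγle⟩, -, -⟩ := h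
  refine ⟨θ, hP, hθ, hθ.toStage9.chart.2.rho8_ne_zero hθ.toStage9.chart.1 hN, hγle, hD, ?_⟩
  subst hD
  exact (N17_datumOfRecord₁₃CoP_iff_merged θ hP hγle).mp hN17

/-- **WHAT N17 DELIVERS AT A STAGE-13 RECORD: (AF-0r) FOR THE RECORD's ONE-LOOP NUMBERS** (companion 4 `af0r_of_N17_atRecord`): `NE4OnData D c ρ w.γ` with
`ρ < 1`, and — asked of every admissible witness with provisos realising `D` — `Beta0LimitExists βmTχ θ.v₀` at COHERENT reference histories with entries in
`]0, w.γ]` ⟹ some such witness θ with `∃ β⁰_∞, |beta0OfMerged βmTχ θ.v₀ k − β⁰_∞| ≤ (c∕(1−ρ))ρ^k` (the `hconv` input of NODE O ∕ K2's consumers; β⁰-side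
hypotheses displayed, not asserted; `0 < w.γ` is the record's clause). [cite: Balaban1987RG1, (2.12)-(2.14) p.268] -/
theorem af0r_of_N17_isRecordOfRecord₁₃CCoP {D : Datum F N} {w : WorldP} (h : IsRecordOfRecord₁₃CCoP F N D w) {c ρ : ℝ} (hρ1 : ρ < 1)
    (hN17 : NE4OnData D c ρ w.γ)
    (hin : ∀ (θ : Stage13Params F N) (hP : θ.Provisos₁₃Core F N), θ.Admissible F N → D = datumOfRecord₁₃CoP F N θ hP → w.γ ≤ θ.γ →
      (letI := θ.instVβ₁; letI := θ.instVβ₂; letI := θ.instιβ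
        Beta0LimitExists (betaMerged F (mergedTermFamilyMatT F N (TcanOfRecord F N) (chiβOfRecord₁₃ F N θ) θ.εbg) θ.ρ8 θ.bV) θ.v₀) ∧
      (∀ k, Fin.tail (θ.v₀ (k + 1)) = θ.v₀ k) ∧ ∀ k i, 0 < θ.v₀ k i ∧ θ.v₀ k i ≤ w.γ) :
    ∃ (θ : Stage13Params F N) (hP : θ.Provisos₁₃Core F N), θ.Admissible F N ∧ D = datumOfRecord₁₃CoP F N θ hP ∧
      letI := θ.instVβ₁; letI := θ.instVβ₂; letI := θ.instιβ
      ∃ binf : ℝ, ∀ k,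
        |beta0OfMerged (betaMerged F (mergedTermFamilyMatT F N (TcanOfRecord F N) (chiβOfRecord₁₃ F N θ) θ.εbg) θ.ρ8 θ.bV) θ.v₀ k - binf| ≤
          c / (1 - ρ) * ρ ^ k := by
  obtain ⟨θ, hP, hθ, hD, -, ⟨hγ0, hγle⟩, -, -⟩ := h
  obtain ⟨hlim, hcoh, hadm⟩ := hin θ hP hθ hD hγle
  refine ⟨θ, hP, hθ, hD, ?_⟩
  subst hD
  letI := θ.instVβ₁; letI := θ.instVβ₂; letI := θ.instιβ
  exact af0r_of_N17_atRecord _ (βfun_datumOfRecord₁₃CoP_eq_mergedTχ θ hP) hγle hγ0 hρ1 hlim hcoh hadm hN17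

/-- **EVERY ₁₃C RECORD HAS def-T's STAGE-5 SHADOW WITH THE SAME β-FUNCTIONS, AT WHICH N17 IS THE SAME STATEMENT** [bookkeeping]
(`Record13.exists_isRecordOfRecord₅C_of_isRecordOfRecord₁₃CCoP`; the re-pointed provisos concern `dens ∕ R ∕ Sect2Form`, not `βfun`). [cite: Balaban1989LargeFieldII, Thm 1 p.355 (bookkeeping)] -/
theorem exists_shadow₅_N17_iff₁₃CoP {D : Datum F N} {w : WorldP} (h : IsRecordOfRecord₁₃CCoP F N D w) :
    ∃ D₅ : Datum F N, IsRecordOfRecord₅C F N D₅ w ∧ D₅.βfun = D.βfun ∧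
      ∀ (c ρ γ' : ℝ), NE4OnData D c ρ γ' ↔ NE4OnData D₅ c ρ γ' := by
  obtain ⟨D₅, h5, -, -, hβ, -⟩ := exists_isRecordOfRecord₅C_of_isRecordOfRecord₁₃CCoP h
  exact ⟨D₅, h5, hβ, fun c ρ γ' => by rw [ne4OnData_iff, ne4OnData_iff, hβ]⟩

/-- **THE SHAPE IN WHICH THE ₁₃C BINDERS HAVE CONTENT** (def-T's `exists_world_isRecordOfRecord₁₃CCoP`): every admissible Stage-13 parameter WITH ITS PROVISOS is a
₁₃C record at some world `w` with ANY prescribed window `0 < γw ≤ θ.γ`, and there N17 on the world's window IS the `βmTχ` rate `ScaleShiftRate c ρ γw` — a K0″-style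
inhabitant `(θ, h, hθ)` makes §62's ∀-forms bite; inhabitation (K0″) is NOT claimed. [cite: Balaban1989LargeFieldII, Thm 1 + (0.1) pp.355-356; Balaban1987RG1, (1.20)-(1.22) p.264] -/
theorem exists_isRecordOfRecord₁₃CCoP_N17_iff (θ : Stage13Params F N) (h : θ.Provisos₁₃Core F N) (hθ : θ.Admissible F N) {γw : ℝ}
    (hγw : 0 < γw ∧ γw ≤ θ.γ) (c ρ : ℝ) :
    ∃ w : WorldP, IsRecordOfRecord₁₃CCoP F N (datumOfRecord₁₃CoP F N θ h) w ∧ w.γ = γw ∧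
      (NE4OnData (datumOfRecord₁₃CoP F N θ h) c ρ w.γ ↔
        letI := θ.instVβ₁; letI := θ.instVβ₂; letI := θ.instιβ
        ScaleShiftRate c ρ γw (betaMerged F (mergedTermFamilyMatT F N (TcanOfRecord F N) (chiβOfRecord₁₃ F N θ) θ.εbg) θ.ρ8 θ.bV)) := by
  obtain ⟨w, hw, hγ⟩ := exists_world_isRecordOfRecord₁₃CCoP F N θ h hθ hγw
  refine ⟨w, hw, hγ, ?_⟩
  rw [hγ]
  exact N17_datumOfRecord₁₃CoP_iff_merged θ h hγw.2

/-! ## §63 THE LINK TO CLUSTER K4's STUB `YMDAG.UVSplit.S_N17 RRec` AT STAGE 13 -/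

/-- **(W2) CLOSER — `S_N17 RRec` FOR EVERY RATE RECORD READING THE STAGE-13 RECORD WITH THE RATE** (kernel): if every bundle `R` of record for `(F, D, g₀, os)`
comes with an admissible Stage-13 witness θ WITH ITS PROVISOS realising `D`, with `R.u3.γ ≤ θ.γ`, at which `βmTχ` has the η-rate at `R.u3`'s dependent letters,
then `S_N17 RRec` — the one-application closer for an `RRec` home keyed over `Stage13Params` (RR-2's `IsDatumOfRecord₁₃CCoP.params` shape). [cite: Balaban1987RG1, (1.20)-(1.22) p.264] -/
theorem s_N17_of_stage13CoP_slot (RRec : RateRecordPred N)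
    (hslot : ∀ (F : T4Family) (D : Datum F N) (g₀ : ℕ → ℝ) (os : List (ULoop F)) (R : RateCarriers N), RRec F D g₀ os R →
      ∃ (θ : Stage13Params F N) (hP : θ.Provisos₁₃Core F N), θ.Admissible F N ∧ D = datumOfRecord₁₃CoP F N θ hP ∧ R.u3.γ ≤ θ.γ ∧
        letI := θ.instVβ₁; letI := θ.instVβ₂; letI := θ.instιβ
        ScaleShiftRate (R.u3.cr * R.u3.C₅ * R.u3.θ) R.u3.ρ R.u3.γ
          (betaMerged F (mergedTermFamilyMatT F N (TcanOfRecord F N) (chiβOfRecord₁₃ F N θ) θ.εbg) θ.ρ8 θ.bV)) :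
    S_N17 RRec := by
  intro F D g₀ os R hR
  obtain ⟨θ, hP, -, hD, hγ, hm⟩ := hslot F D g₀ os R hR
  subst hD
  exact (n17At_datumOfRecord₁₃CoP_iff_merged θ hP R.u3 hγ).mpr hm

/-- **(W2) CLOSER FOR AN `RRec` HOME KEYED TO `IsRecordOfRecord₁₃CCoP`**: if every bundle `R` of record for `(F, D, g₀, os)` comes with a world `w` making `(D, w)` a
Stage-13 record whose window IS node U3's box (`R.u3.γ = w.γ`), and the `βmTχ` rate at `R.u3`'s letters is supplied in §62's ∀-form, then `S_N17 RRec`.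
Stage-free alternatives (not restated): `YMDAG.N17.s_N17_of_D4_N18` (U3 road), `YMDAG.N17.n17At_of_transferModel`. [cite: Balaban1987RG1, (1.20)-(1.22) p.264] -/
theorem s_N17_of_rec₁₃CoPC (RRec : RateRecordPred N)
    (hhome : ∀ (F : T4Family) (D : Datum F N) (g₀ : ℕ → ℝ) (os : List (ULoop F)) (R : RateCarriers N), RRec F D g₀ os R →
      ∃ w : WorldP, IsRecordOfRecord₁₃CCoP F N D w ∧ R.u3.γ = w.γ)
    (hin : ∀ (F : T4Family) (D : Datum F N) (g₀ : ℕ → ℝ) (os : List (ULoop F)) (R : RateCarriers N), RRec F D g₀ os R →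
      ∀ (θ : Stage13Params F N) (hP : θ.Provisos₁₃Core F N), θ.Admissible F N → D = datumOfRecord₁₃CoP F N θ hP → R.u3.γ ≤ θ.γ →
        letI := θ.instVβ₁; letI := θ.instVβ₂; letI := θ.instιβ
        ScaleShiftRate (R.u3.cr * R.u3.C₅ * R.u3.θ) R.u3.ρ R.u3.γ
          (betaMerged F (mergedTermFamilyMatT F N (TcanOfRecord F N) (chiβOfRecord₁₃ F N θ) θ.εbg) θ.ρ8 θ.bV)) :
    S_N17 RRec := by
  intro F D g₀ os R hR
  obtain ⟨w, hw, hγ⟩ := hhome F D g₀ os R hR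
  show NE4OnData D _ _ _
  rw [hγ]
  exact N17_of_isRecordOfRecord₁₃CCoP hw fun θ hP hθ hD hle => hγ ▸ hin F D g₀ os R hR θ hP hθ hD (hγ.le.trans hle)

end Summit.QuantumFields.YangMills.Theorems.BalabanUVNodesN17

end
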